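import Summits.AtomisticToContinuum.HydrodynamicLimit.Theorems.LambertianContactSwapLambertianEulerIterateGood

/-!
# GST iteration for the Lambertian hard-sphere flow, II: Liouville ⊗ noise invariance
# (`LambertianContactSwap.LambertianEuler`, stmt-AtomisticToContinuum-11854, line `Sketch`; stub `stub_iterateLambda`)

Continuation of `…LambertianEulerIterateGood`, verbatim after `Literature.Analysis.FluidPDE.HardSphereAlexander`:
(A) the survivors `iterGoodL k` do not lose `vol ⊗ γ^ℕ`-volume under `Λ_{(k+1)δ}`; (C) the pairs of an energy shell
lost in `k + 1` windows have measure `≤ (k+1) L`; `δ = t/(m+1)`, `m → ∞`: sub-invariance of `Λ_t` and a.e. regularity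
up to `t` on every shell; equal finite masses: invariance on shells; `V → ∞` and the union of the null irregular sets:
`(liouville ⊗ γ^ℕ) ∘ Λ_t⁻¹ = liouville` for all `t ≥ 0` and a.e. non-accumulation of the collision instants
(`stub_iterateLambda`). [cite: GST2013, proof of Prop. 4.1.1 p. 19]
-/

noncomputable section

open scoped BigOperators Topology ENNReal InnerProductSpace
open MeasureTheory ProbabilityTheory Filter Set Literature.MathematicalPhysics.KineticTheory
open Literature.Analysis.FluidPDE Literature.Analysis.FluidPDE.Alexander
open Summit.AtomisticToContinuum.HydrodynamicLimit.Theorems.LambertianContactSwapLambertianEulerIterateGood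

namespace Summit.AtomisticToContinuum.HydrodynamicLimit.Theorems.LambertianContactSwapLambertianEulerIterate

local notation "G₃" => Torus.geometry (Fin 3)
local notation "γ₃" => lambertNoise (Fin 3)

/-- `volume` on the `N`-particle phase space over `𝕋³` is σ-finite (local-instance shortcut for a slow search). [folklore] -/
theorem sigmaFinite_volume_config (N : ℕ) : SigmaFinite (volume : Measure (Config N (Fin 3) T3)) := by
  have hXE : SigmaFinite (volume : Measure (T3 × V3)) := inferInstance
  infer_instance

/-- Every datum lies in an energy shell of natural speed bound. [folklore] -/
theorem exists_nat_configEnergy_le {N : ℕ} (z : Config N (Fin 3) T3) : ∃ V : ℕ, configEnergy z ≤ (V : ℝ) ^ 2 / 2 := by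
  obtain ⟨V, hV⟩ := exists_nat_ge (max 1 (2 * configEnergy z))
  exact ⟨V, by nlinarith [le_trans (le_max_left _ _) hV, le_trans (le_max_right _ _) hV]⟩

variable {N : ℕ} {ε r δ V : ℝ}

variable (hM : ∀ (z : Config N (Fin 3) T3) (s : ℝ), 0 ≤ s → ∀ {m : ℕ} (r : Fin m → ℝ), (∀ i, 0 ≤ r i ∧ r i ≤ s) →
    ∀ {Q : Set (Fin m → Config N (Fin 3) T3)}, MeasurableSet Q → ∀ {H : Config N (Fin 3) T3 × (ℕ → V3) → ℝ≥0∞}, Measurable H →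
      ∫⁻ ξs, {ξs : ℕ → V3 | (∃ k, ENNReal.ofReal s < lambertInstant G₃ ε ξs z k) ∧
          (fun i => lambertFlow G₃ ε ξs z (r i)) ∈ Q}.indicator
          (fun ξs => H (lambertFlow G₃ ε ξs z s, fun n => ξs (n + lambertCount G₃ ε ξs z s))) ξs ∂γ₃ =
      ∫⁻ ξs, {ξs : ℕ → V3 | (∃ k, ENNReal.ofReal s < lambertInstant G₃ ε ξs z k) ∧
          (fun i => lambertFlow G₃ ε ξs z (r i)) ∈ Q}.indicator (fun ξs => ∫⁻ ηs, H (lambertFlow G₃ ε ξs z s, ηs) ∂γ₃) ξs ∂γ₃)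
  (hW1 : ∀ B : Set (Config N (Fin 3) T3), MeasurableSet B →
    ((volume.restrict {z : Config N (Fin 3) T3 | z ∈ shortGood N ε r δ ∧ configEnergy z ≤ V ^ 2 / 2}).prod γ₃)
      {p | lambertFlow G₃ ε p.2 p.1 δ ∈ B} ≤ volume B)
  (hW2 : ∀ z : Config N (Fin 3) T3, z ∈ shortGood N ε r δ → configEnergy z ≤ V ^ 2 / 2 →
    ∀ᵐ ξs ∂γ₃, (∃ k, ENNReal.ofReal δ < lambertInstant G₃ ε ξs z k) ∧ lambertFlow G₃ ε ξs z δ ∈ hardSphereDomain G₃ N ε)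
  (hW : ∀ {V r δ : ℝ}, 0 ≤ V → 0 ≤ δ → 4 * V * δ ≤ r → ε + 2 * r < 2⁻¹ → (∀ B : Set (Config N (Fin 3) T3), MeasurableSet B →
      ((volume.restrict {z : Config N (Fin 3) T3 | z ∈ shortGood N ε r δ ∧ configEnergy z ≤ V ^ 2 / 2}).prod γ₃)
        {p | lambertFlow G₃ ε p.2 p.1 δ ∈ B} ≤ volume B) ∧
    (∀ z : Config N (Fin 3) T3, z ∈ shortGood N ε r δ → configEnergy z ≤ V ^ 2 / 2 →
      ∀ᵐ ξs ∂γ₃, (∃ k, ENNReal.ofReal δ < lambertInstant G₃ ε ξs z k) ∧ lambertFlow G₃ ε ξs z δ ∈ hardSphereDomain G₃ N ε))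

include hM hW1 hW2 in
/-- **The survivors do not lose volume under the Lambertian flow** (copy of `Alexander.volume_iterGood_inter_preimage_le`):
`(vol ⊗ γ^ℕ) {p ∈ iterGoodL k | Λ_{(k+1)δ} p ∈ B} ≤ vol B`. Induction on `k`: `k = 0` is clause 1 of WINDOW; for `k + 1`,
off a null set the cocycle writes `Λ_{s+δ} = Λ_δ(Λ_s; unused noise)`, `s = (k+1)δ`, the fresh-tail transfer replaces the
unused noise by a fresh sequence, the induction hypothesis bounds the image of `(vol ⊗ γ^ℕ)|iterGoodL k` under `Λ_s`
by `vol`, and clause 1 of WINDOW concludes. [cite: GST2013, proof of Prop. 4.1.1 p. 19] -/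
theorem measure_iterGoodL_inter_preimage_le (hε' : ε < 2⁻¹) (hδ : 0 ≤ δ) :
    ∀ (k : ℕ) ⦃B : Set (Config N (Fin 3) T3)⦄, MeasurableSet B → (volume.prod γ₃)
      (iterGoodL N ε r δ V k ∩ {p | lambertFlow G₃ ε p.2 p.1 (((k : ℝ) + 1) * δ) ∈ B}) ≤ volume B := by
  have hG := Torus.isHardSphereRegular_geometry (d := Fin 3) hε'
  set Sg : Set (Config N (Fin 3) T3) := {z | z ∈ shortGood N ε r δ ∧ configEnergy z ≤ V ^ 2 / 2}
  have hSg : MeasurableSet Sg := (measurableSet_shortGood ε r δ).inter (measurableSet_energyShell _)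
  have hΛδ := measurable_lambertFlow_torus (d := Fin 3) (N := N) hε' δ
  haveI := sigmaFinite_volume_config N
  intro k
  induction k with
  | zero =>
    intro B hB
    have hmeas : MeasurableSet {p : Config N (Fin 3) T3 × (ℕ → V3) | lambertFlow G₃ ε p.2 p.1 δ ∈ B} := hΛδ hB
    have h0 : iterGoodL N ε r δ V 0 ∩ {p | lambertFlow G₃ ε p.2 p.1 ((((0 : ℕ) : ℝ) + 1) * δ) ∈ B} ⊆
        {p | lambertFlow G₃ ε p.2 p.1 δ ∈ B} ∩ Sg ×ˢ (univ : Set (ℕ → V3)) := fun p hp =>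
      ⟨by simpa only [Nat.cast_zero, zero_add, one_mul, mem_setOf_eq] using hp.2, ⟨hp.1.1, hp.1.2.1⟩, mem_univ _⟩
    refine (measure_mono h0).trans ?_
    rw [← Measure.restrict_apply hmeas, ← Measure.restrict_prod_eq_prod_univ]
    exact hW1 B hB
  | succ k ih =>
    intro B hB
    set s : ℝ := ((k : ℝ) + 1) * δ with hs_def
    have hs : 0 ≤ s := by positivity
    have hcast : (((k + 1 : ℕ) : ℝ) + 1) * δ = s + δ := by rw [hs_def]; push_cast; ring
    rw [hcast]
    have hΛs := measurable_lambertFlow_torus (d := Fin 3) (N := N) hε' s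
    set rst : Config N (Fin 3) T3 × (ℕ → V3) → Config N (Fin 3) T3 × (ℕ → V3) :=
      fun p => (lambertFlow G₃ ε p.2 p.1 s, fun n => p.2 (n + lambertCount G₃ ε p.2 p.1 s)) with hrst
    have hRst : Measurable rst := hΛs.prodMk
      (measurable_shift (measurable_lambertCount hG Torus.isMeasurable_geometry s) measurable_snd)
    have hT := measurableSet_iterGoodL (N := N) (r := r) (δ := δ) (V := V) hε' (k + 1)
    have hTk := measurableSet_iterGoodL (N := N) (r := r) (δ := δ) (V := V) hε' k
    set T := iterGoodL N ε r δ V (k + 1) with hT_def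
    set B' : Set (Config N (Fin 3) T3 × (ℕ → V3)) := {q | lambertFlow G₃ ε q.2 q.1 δ ∈ B} with hB'_def
    have hB' : MeasurableSet B' := hΛδ hB
    set g : Config N (Fin 3) T3 → ℝ≥0∞ := fun w =>
      ∫⁻ ηs, B'.indicator (1 : Config N (Fin 3) T3 × (ℕ → V3) → ℝ≥0∞) (w, ηs) ∂γ₃
    have hg : Measurable g := (measurable_one.indicator hB').lintegral_prod_right'
    have hbad := measure_iterGoodL_bad_eq_zero hM hW2 hε' hδ (k + 1)
    rw [hcast] at hbad
    have hle : (((volume.prod γ₃).restrict (iterGoodL N ε r δ V k)).map (fun p => lambertFlow G₃ ε p.2 p.1 s)) ≤ volume := by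
      rw [Measure.le_iff]
      intro C hC
      rw [Measure.map_apply hΛs hC, Measure.restrict_apply (hΛs hC), inter_comm]
      exact ih hC
    calc (volume.prod γ₃) (T ∩ {p | lambertFlow G₃ ε p.2 p.1 (s + δ) ∈ B}) ≤ (volume.prod γ₃) ((T ∩ {p | rst p ∈ B'}) ∪ (T ∩ {p |
              ¬ (∃ j, ENNReal.ofReal (s + δ) < lambertInstant G₃ ε p.2 p.1 j) ∨
                lambertFlow G₃ ε p.2 p.1 (s + δ) ∉ hardSphereDomain G₃ N ε})) := by
          refine measure_mono ?_
          rintro ⟨z, ξs⟩ ⟨hg', hb⟩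
          by_cases hSU : ∃ j, ENNReal.ofReal (s + δ) < lambertInstant G₃ ε ξs z j
          · refine Or.inl ⟨hg', ?_⟩
            have hS : ∃ j, ENNReal.ofReal s < lambertInstant G₃ ε ξs z j := (hg'.2.2 k (Nat.lt_succ_self k)).2
            simp only [mem_setOf_eq, hrst, hB'_def] at hb ⊢
            rwa [← lambertFlow_add_restart hs hδ hS hSU]
          · exact Or.inr ⟨hg', Or.inl hSU⟩
      _ ≤ (volume.prod γ₃) (T ∩ {p | rst p ∈ B'}) + 0 := by rw [← hbad]; exact measure_union_le _ _
      _ = ∫⁻ p, (T ∩ {p | rst p ∈ B'}).indicator 1 p ∂(volume.prod γ₃) := by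
          rw [add_zero]; exact (lintegral_indicator_one (hT.inter (hRst hB'))).symm
      _ = ∫⁻ p, T.indicator (fun p => B'.indicator (1 : Config N (Fin 3) T3 × (ℕ → V3) → ℝ≥0∞) (rst p)) p
            ∂(volume.prod γ₃) := lintegral_congr fun p => indicator_inter_preimage_one _ _ _ p
      _ = ∫⁻ p, T.indicator (fun p => g (lambertFlow G₃ ε p.2 p.1 s)) p ∂(volume.prod γ₃) :=
          lintegral_iterGoodL_succ_fresh hM hε' hδ k (measurable_one.indicator hB')
      _ ≤ ∫⁻ p, (iterGoodL N ε r δ V k).indicator (fun p => Sg.indicator g (lambertFlow G₃ ε p.2 p.1 s)) p ∂(volume.prod γ₃) := by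
          refine lintegral_mono fun p => ?_
          by_cases hp : p ∈ T
          · have hw : lambertFlow G₃ ε p.2 p.1 s ∈ Sg :=
              ⟨(hp.2.2 k (Nat.lt_succ_self k)).1, (configEnergy_lambertFlow_le _ _ _).trans hp.2.1⟩
            rw [Set.indicator_of_mem hp, Set.indicator_of_mem (iterGoodL_succ_subset k hp), Set.indicator_of_mem hw]
          · rw [Set.indicator_of_notMem hp]
            exact bot_le
      _ = ∫⁻ p in iterGoodL N ε r δ V k, Sg.indicator g (lambertFlow G₃ ε p.2 p.1 s) ∂(volume.prod γ₃) :=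
          lintegral_indicator hTk _
      _ = ∫⁻ w, Sg.indicator g w ∂(((volume.prod γ₃).restrict (iterGoodL N ε r δ V k)).map
            (fun p => lambertFlow G₃ ε p.2 p.1 s)) := (lintegral_map (hg.indicator hSg) hΛs).symm
      _ ≤ ∫⁻ w, Sg.indicator g w ∂volume := lintegral_mono' hle le_rfl
      _ = ∫⁻ w in Sg, g w ∂volume := lintegral_indicator hSg _
      _ = ∫⁻ q, B'.indicator 1 q ∂((volume.restrict Sg).prod γ₃) :=
          (lintegral_prod _ (measurable_one.indicator hB').aemeasurable).symm
      _ = ((volume.restrict Sg).prod γ₃) B' := lintegral_indicator_one hB'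
      _ ≤ volume B := hW1 B hB

include hM hW1 hW2 in
/-- **The volume lost in `k + 1` windows** (copy of `Alexander.volume_shell_diff_iterGood_le`): if the short-time bad part
`{z ∈ D | E ≤ V²/2, z ∉ shortGood}` has volume `≤ L`, the pairs of the shell not surviving `k + 1` windows have measure
`≤ (k + 1) L` (a survivor fails the next window only if `Λ_{(k+1)δ}` lands in the bad part, or off a null set).
[cite: GST2013, proof of Prop. 4.1.1 p. 19] -/
theorem measure_shell_diff_iterGoodL_le (hε' : ε < 2⁻¹) (hδ : 0 ≤ δ) {L : ℝ≥0∞}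
    (hL : volume {z : Config N (Fin 3) T3 | z ∈ hardSphereDomain G₃ N ε ∧
      configEnergy z ≤ V ^ 2 / 2 ∧ z ∉ shortGood N ε r δ} ≤ L) (k : ℕ) :
    (volume.prod γ₃) ({z : Config N (Fin 3) T3 | z ∈ hardSphereDomain G₃ N ε ∧
        configEnergy z ≤ V ^ 2 / 2} ×ˢ (univ : Set (ℕ → V3)) \ iterGoodL N ε r δ V k) ≤ ((k : ℝ≥0∞) + 1) * L := by
  have hD : MeasurableSet (hardSphereDomain G₃ N ε) := measurableSet_hardSphereDomain _ Torus.measurable_geometry_sepVec N ε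
  set Bset : Set (Config N (Fin 3) T3) := {z | z ∈ hardSphereDomain G₃ N ε ∧
    configEnergy z ≤ V ^ 2 / 2 ∧ z ∉ shortGood N ε r δ} with hBset_def
  induction k with
  | zero =>
    rw [Nat.cast_zero, zero_add, one_mul]
    calc (volume.prod γ₃) ({z : Config N (Fin 3) T3 | z ∈ hardSphereDomain G₃ N ε ∧
            configEnergy z ≤ V ^ 2 / 2} ×ˢ (univ : Set (ℕ → V3)) \ iterGoodL N ε r δ V 0)
        ≤ (volume.prod γ₃) (Bset ×ˢ (univ : Set (ℕ → V3))) := by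
          refine measure_mono fun p hp => ⟨⟨hp.1.1.1, hp.1.1.2, fun hsg => hp.2 ?_⟩, mem_univ _⟩
          exact ⟨hsg, hp.1.1.2, fun i hi => (Nat.not_lt_zero i hi).elim⟩
      _ ≤ L := by rw [Measure.prod_prod, measure_univ, mul_one]; exact hL
  | succ k ih =>
    have hBset : MeasurableSet Bset := hD.inter ((measurableSet_energyShell _).inter (measurableSet_shortGood ε r δ).compl)
    have hA := measure_iterGoodL_inter_preimage_le hM hW1 hW2 hε' hδ k hBset
    have hB := measure_iterGoodL_bad_eq_zero hM hW2 hε' hδ k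
    calc (volume.prod γ₃) ({z : Config N (Fin 3) T3 | z ∈ hardSphereDomain G₃ N ε ∧
            configEnergy z ≤ V ^ 2 / 2} ×ˢ (univ : Set (ℕ → V3)) \ iterGoodL N ε r δ V (k + 1))
        ≤ (volume.prod γ₃) (({z : Config N (Fin 3) T3 | z ∈ hardSphereDomain G₃ N ε ∧
              configEnergy z ≤ V ^ 2 / 2} ×ˢ (univ : Set (ℕ → V3)) \ iterGoodL N ε r δ V k) ∪
            ((iterGoodL N ε r δ V k ∩ {p | lambertFlow G₃ ε p.2 p.1 (((k : ℝ) + 1) * δ) ∈ Bset}) ∪ (iterGoodL N ε r δ V k ∩ {p |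
                ¬ (∃ j, ENNReal.ofReal (((k : ℝ) + 1) * δ) < lambertInstant G₃ ε p.2 p.1 j) ∨
                  lambertFlow G₃ ε p.2 p.1 (((k : ℝ) + 1) * δ) ∉ hardSphereDomain G₃ N ε}))) := by
          refine measure_mono fun p hp => ?_
          by_cases hpk : p ∈ iterGoodL N ε r δ V k
          · refine Or.inr ?_
            by_cases hex : ∃ j, ENNReal.ofReal (((k : ℝ) + 1) * δ) < lambertInstant G₃ ε p.2 p.1 j
            · by_cases hDm : lambertFlow G₃ ε p.2 p.1 (((k : ℝ) + 1) * δ) ∈ hardSphereDomain G₃ N ε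
              · refine Or.inl ⟨hpk, hDm, (configEnergy_lambertFlow_le _ _ _).trans hpk.2.1, fun hsg => hp.2 ?_⟩
                refine ⟨hpk.1, hpk.2.1, fun i hi => ?_⟩
                rcases (Nat.lt_succ_iff.1 hi).lt_or_eq with hik | hik
                · exact hpk.2.2 i hik
                · rw [hik]; exact ⟨hsg, hex⟩
              · exact Or.inr ⟨hpk, Or.inr hDm⟩
            · exact Or.inr ⟨hpk, Or.inl hex⟩
          · exact Or.inl ⟨hp.1, hpk⟩
      _ ≤ ((k : ℝ≥0∞) + 1) * L + (L + 0) := by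
          refine (measure_union_le _ _).trans (add_le_add ih ?_)
          exact (measure_union_le _ _).trans (add_le_add (hA.trans hL) hB.le)
      _ = (((k + 1 : ℕ) : ℝ≥0∞) + 1) * L := by push_cast; ring

include hM hW in
/-- **Sub-invariance and regularity on energy shells**: granted WINDOW (`hW`) and MARKOV (`hM`), for every speed bound
`V₀ ≥ 0` and horizon `t ≥ 0`, on the shell `(D ∩ {E ≤ V₀²/2}) × (ℕ → V3)`: (i) `(vol ⊗ γ^ℕ) {Λ_t ∈ B} ≤ vol B`, (ii) almost
surely the collision instants pass `t` and `Λ_t ∈ D`. With `δ = t/(m+1)` and interaction length `4V₀δ`, both hold up to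
the loss `(m+1) · windowLoss δ (2V₀) → 0` (`Alexander.tendsto_windowLoss`). [cite: GST2013, proof of Prop. 4.1.1 p. 19] -/
theorem lambda_shell_bounds (hε : 0 < ε) (hε' : ε < 2⁻¹) {V₀ t : ℝ} (hV0 : 0 ≤ V₀) (ht : 0 ≤ t) :
    (∀ B : Set (Config N (Fin 3) T3), MeasurableSet B → (volume.prod γ₃) ({z : Config N (Fin 3) T3 | z ∈ hardSphereDomain G₃ N ε ∧
        configEnergy z ≤ V₀ ^ 2 / 2} ×ˢ (univ : Set (ℕ → V3)) ∩ {p | lambertFlow G₃ ε p.2 p.1 t ∈ B}) ≤ volume B) ∧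
      (volume.prod γ₃) ({z : Config N (Fin 3) T3 | z ∈ hardSphereDomain G₃ N ε ∧ configEnergy z ≤ V₀ ^ 2 / 2} ×ˢ (univ : Set (ℕ → V3)) ∩
        {p | ¬ (∃ j, ENNReal.ofReal t < lambertInstant G₃ ε p.2 p.1 j) ∨ lambertFlow G₃ ε p.2 p.1 t ∉ hardSphereDomain G₃ N ε}) = 0 := by
  have h2V0 : 0 ≤ 2 * V₀ := by positivity
  have hVV : V₀ ^ 2 / 2 ≤ (2 * V₀) ^ 2 / 2 := by nlinarith [sq_nonneg V₀]
  set S : Set (Config N (Fin 3) T3) := {z | z ∈ hardSphereDomain G₃ N ε ∧ configEnergy z ≤ V₀ ^ 2 / 2}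
  -- both bounds for the window `δ = t/(m+1)`, up to the loss of `m + 1` windows
  have key : ∀ m : ℕ, ε + 2 * (2 * (2 * V₀) * (t / ((m : ℝ) + 1))) < 2⁻¹ → (∀ B : Set (Config N (Fin 3) T3), MeasurableSet B →
        (volume.prod γ₃) (S ×ˢ (univ : Set (ℕ → V3)) ∩ {p | lambertFlow G₃ ε p.2 p.1 t ∈ B}) ≤
          volume B + ((m : ℝ≥0∞) + 1) * windowLoss (d := Fin 3) N (t / ((m : ℝ) + 1)) (2 * V₀)) ∧
      (volume.prod γ₃) (S ×ˢ (univ : Set (ℕ → V3)) ∩ {p | ¬ (∃ j, ENNReal.ofReal t < lambertInstant G₃ ε p.2 p.1 j) ∨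
            lambertFlow G₃ ε p.2 p.1 t ∉ hardSphereDomain G₃ N ε}) ≤
        ((m : ℝ≥0∞) + 1) * windowLoss (d := Fin 3) N (t / ((m : ℝ) + 1)) (2 * V₀) := by
    intro m hch
    have hδ : 0 ≤ t / ((m : ℝ) + 1) := by positivity
    have hT : ((m : ℝ) + 1) * (t / ((m : ℝ) + 1)) = t := by field_simp
    have hr4 : 4 * V₀ * (t / ((m : ℝ) + 1)) ≤ 2 * (2 * V₀) * (t / ((m : ℝ) + 1)) := le_of_eq (by ring)
    obtain ⟨hW1, hW2⟩ := hW hV0 hδ hr4 hch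
    have hL : volume {z : Config N (Fin 3) T3 | z ∈ hardSphereDomain G₃ N ε ∧
        configEnergy z ≤ V₀ ^ 2 / 2 ∧ z ∉ shortGood N ε (2 * (2 * V₀) * (t / ((m : ℝ) + 1)))
          (t / ((m : ℝ) + 1))} ≤ windowLoss (d := Fin 3) N (t / ((m : ℝ) + 1)) (2 * V₀) := by
      refine le_trans (measure_mono fun z hz => ?_) (volume_shell_diff_shortGood_le hε hch h2V0 hδ)
      exact ⟨hz.1, hz.2.1.trans hVV, hz.2.2⟩
    have hA := measure_iterGoodL_inter_preimage_le hM hW1 hW2 hε' hδ m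
    have hB := measure_iterGoodL_bad_eq_zero hM hW2 hε' hδ m
    have hC := measure_shell_diff_iterGoodL_le hM hW1 hW2 hε' hδ hL m
    rw [hT] at hA hB
    have hsplit : ∀ X : Set (Config N (Fin 3) T3 × (ℕ → V3)), (volume.prod γ₃) (S ×ˢ (univ : Set (ℕ → V3)) ∩ X) ≤
        (volume.prod γ₃) (iterGoodL N ε (2 * (2 * V₀) * (t / ((m : ℝ) + 1))) (t / ((m : ℝ) + 1)) V₀ m ∩ X) +
        (volume.prod γ₃) (S ×ˢ (univ : Set (ℕ → V3)) \
          iterGoodL N ε (2 * (2 * V₀) * (t / ((m : ℝ) + 1))) (t / ((m : ℝ) + 1)) V₀ m) := by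
      intro X
      refine le_trans (measure_mono fun p hp => ?_) (measure_union_le _ _)
      by_cases hpm : p ∈ iterGoodL N ε (2 * (2 * V₀) * (t / ((m : ℝ) + 1))) (t / ((m : ℝ) + 1)) V₀ m
      · exact Or.inl ⟨hpm, hp.2⟩
      · exact Or.inr ⟨hp.1, hpm⟩
    refine ⟨fun B hB' => (hsplit _).trans (add_le_add (hA hB') hC), ?_⟩
    exact (hsplit _).trans ((add_le_add hB.le hC).trans_eq (zero_add _))
  have hlim := tendsto_windowLoss (d := Fin 3) (N := N) h2V0 ht
  refine ⟨fun B hB => ?_, le_antisymm (ge_of_tendsto hlim ?_) bot_le⟩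
  · have hlim' : Tendsto (fun m : ℕ => volume B +
        ((m : ℝ≥0∞) + 1) * windowLoss (d := Fin 3) N (t / ((m : ℝ) + 1)) (2 * V₀)) atTop (𝓝 (volume B)) := by
      have h := (tendsto_const_nhds : Tendsto (fun _ : ℕ => volume B) atTop (𝓝 (volume B))).add hlim
      rwa [add_zero] at h
    refine ge_of_tendsto hlim' ?_
    filter_upwards [eventually_chart hε' (2 * V₀) t] with m hm
    exact (key m hm).1 B hB
  · filter_upwards [eventually_chart hε' (2 * V₀) t] with m hm
    exact (key m hm).2

omit hM hW1 hW2 hW in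
/-- **Invariance on an energy shell from sub-invariance** (complement trick of `Alexander.volume_good_shell_inter_preimage_eq`):
if on `S = D ∩ {E ≤ V²/2}` the image of `(vol ⊗ γ^ℕ)|_{S × univ}` under `Λ_t` is dominated by `vol` and `Λ_t ∈ D` a.s., then it
is `vol|_S` (energy decreases along `Λ`; `S` has finite volume; equal total masses). [cite: CIP1994, App. 4.A pp. 107–111] -/
theorem measure_shell_inter_preimage_eq (hε' : ε < 2⁻¹) {V t : ℝ} (hV0 : 0 ≤ V)
    (hle : ∀ B : Set (Config N (Fin 3) T3), MeasurableSet B →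
      (volume.prod γ₃) ({z : Config N (Fin 3) T3 | z ∈ hardSphereDomain G₃ N ε ∧
          configEnergy z ≤ V ^ 2 / 2} ×ˢ (univ : Set (ℕ → V3)) ∩ {p | lambertFlow G₃ ε p.2 p.1 t ∈ B}) ≤ volume B)
    (hnull : (volume.prod γ₃) ({z : Config N (Fin 3) T3 | z ∈ hardSphereDomain G₃ N ε ∧
          configEnergy z ≤ V ^ 2 / 2} ×ˢ (univ : Set (ℕ → V3)) ∩ {p | ¬ (∃ j, ENNReal.ofReal t < lambertInstant G₃ ε p.2 p.1 j) ∨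
          lambertFlow G₃ ε p.2 p.1 t ∉ hardSphereDomain G₃ N ε}) = 0) {B : Set (Config N (Fin 3) T3)} (hB : MeasurableSet B) :
    (volume.prod γ₃) ({z : Config N (Fin 3) T3 | z ∈ hardSphereDomain G₃ N ε ∧
          configEnergy z ≤ V ^ 2 / 2} ×ˢ (univ : Set (ℕ → V3)) ∩ {p | lambertFlow G₃ ε p.2 p.1 t ∈ B}) =
      volume ({z : Config N (Fin 3) T3 | z ∈ hardSphereDomain G₃ N ε ∧ configEnergy z ≤ V ^ 2 / 2} ∩ B) := by
  set S : Set (Config N (Fin 3) T3) := {z | z ∈ hardSphereDomain G₃ N ε ∧ configEnergy z ≤ V ^ 2 / 2}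
  have hSm : MeasurableSet S :=
    (measurableSet_hardSphereDomain _ Torus.measurable_geometry_sepVec N ε).inter (measurableSet_energyShell _)
  have hΛ := measurable_lambertFlow_torus (d := Fin 3) (N := N) hε' t
  have hfin : volume S ≠ ∞ := by
    refine ((measure_mono fun z hz => setOf_configEnergy_le_subset_velBall hV0 hz.2).trans_lt ?_).ne
    rw [volume_velBall]
    exact ENNReal.pow_lt_top measure_closedBall_lt_top
  -- `Λ_t ∈ S` almost surely on `S × univ`
  have hconc : (volume.prod γ₃) (S ×ˢ univ ∩ {p | lambertFlow G₃ ε p.2 p.1 t ∉ S}) = 0 := by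
    refine measure_mono_null (fun p hp => ?_) hnull
    exact ⟨hp.1, Or.inr fun hDm => hp.2 ⟨hDm, (configEnergy_lambertFlow_le _ _ _).trans hp.1.1.2⟩⟩
  -- sub-invariance relative to `S`
  have hle' : ∀ C : Set (Config N (Fin 3) T3), MeasurableSet C →
      (volume.prod γ₃) (S ×ˢ univ ∩ {p | lambertFlow G₃ ε p.2 p.1 t ∈ C}) ≤ volume (S ∩ C) := by
    intro C hC
    calc (volume.prod γ₃) (S ×ˢ univ ∩ {p | lambertFlow G₃ ε p.2 p.1 t ∈ C})
        ≤ (volume.prod γ₃) ((S ×ˢ univ ∩ {p | lambertFlow G₃ ε p.2 p.1 t ∈ S ∩ C}) ∪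
            (S ×ˢ univ ∩ {p | lambertFlow G₃ ε p.2 p.1 t ∉ S})) := by
          refine measure_mono fun p hp => ?_
          by_cases h : lambertFlow G₃ ε p.2 p.1 t ∈ S
          · exact Or.inl ⟨hp.1, h, hp.2⟩
          · exact Or.inr ⟨hp.1, h⟩
      _ ≤ (volume.prod γ₃) (S ×ˢ univ ∩ {p | lambertFlow G₃ ε p.2 p.1 t ∈ S ∩ C}) + 0 := by
          rw [← hconc]; exact measure_union_le _ _
      _ ≤ volume (S ∩ C) := by rw [add_zero]; exact hle _ (hSm.inter hC)
  have h2 : (volume.prod γ₃) (S ×ˢ univ \ {p | lambertFlow G₃ ε p.2 p.1 t ∈ B}) ≤ volume (S \ B) := by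
    have e1 : S ×ˢ univ \ {p : Config N (Fin 3) T3 × (ℕ → V3) | lambertFlow G₃ ε p.2 p.1 t ∈ B} =
        S ×ˢ univ ∩ {p | lambertFlow G₃ ε p.2 p.1 t ∈ Bᶜ} := Set.ext fun _ => Iff.rfl
    rw [e1, sdiff_eq]
    exact hle' Bᶜ hB.compl
  have hPm : MeasurableSet {p : Config N (Fin 3) T3 × (ℕ → V3) | lambertFlow G₃ ε p.2 p.1 t ∈ B} := hΛ hB
  have hsum : (volume.prod γ₃) (S ×ˢ univ ∩ {p | lambertFlow G₃ ε p.2 p.1 t ∈ B}) +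
      (volume.prod γ₃) (S ×ˢ univ \ {p | lambertFlow G₃ ε p.2 p.1 t ∈ B}) = volume S := by
    rw [measure_inter_add_sdiff _ hPm, Measure.prod_prod, measure_univ, mul_one]
  have hsum' : volume (S ∩ B) + volume (S \ B) = volume S := measure_inter_add_sdiff _ hB
  exact ennreal_eq_of_add_eq_add_of_le (hle' B hB) h2 (hsum.trans hsum'.symm) (by rw [hsum']; exact hfin)

omit hM hW1 hW2 hW in
/-- **`stub_iterateLambda`** (line `Sketch` of the crux `LambertianContactSwap.LambertianEuler`; hard spheres of diameter
`0 < ε < 1/2` on `𝕋³`, Liouville measure `liouville`, noise `γ^ℕ = lambertNoise`): granted the one-window hypothesis WINDOW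
and the restricted strong Markov property MARKOV of the i.i.d. redraws: (1) **Liouville ⊗ noise invariance**
`(liouville ⊗ γ^ℕ) ∘ Λ_t⁻¹ = liouville` for every `t ≥ 0`; (2) **a.e. non-accumulation** of the collision instants
(`lambda_shell_bounds`; equal masses on shells; exhaustion `V → ∞`; union of null sets). [cite: GST2013, proof of Prop. 4.1.1 p. 19] -/
theorem stub_iterateLambda :
    ∀ {ε : ℝ}, 0 < ε → ε < 2⁻¹ → ∀ {N : ℕ},
      (∀ {V r δ : ℝ}, 0 ≤ V → 0 ≤ δ → 4 * V * δ ≤ r → ε + 2 * r < 2⁻¹ →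
        (∀ B : Set (Config N (Fin 3) T3), MeasurableSet B →
          ((volume.restrict {z : Config N (Fin 3) T3 |
              z ∈ shortGood N ε r δ ∧ configEnergy z ≤ V ^ 2 / 2}).prod (lambertNoise (Fin 3)))
            {p | lambertFlow (Torus.geometry (Fin 3)) ε p.2 p.1 δ ∈ B} ≤ volume B) ∧
        (∀ z : Config N (Fin 3) T3, z ∈ shortGood N ε r δ → configEnergy z ≤ V ^ 2 / 2 →
          ∀ᵐ ξs ∂(lambertNoise (Fin 3)),
            (∃ k, ENNReal.ofReal δ < lambertInstant (Torus.geometry (Fin 3)) ε ξs z k) ∧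
            lambertFlow (Torus.geometry (Fin 3)) ε ξs z δ ∈
              hardSphereDomain (Torus.geometry (Fin 3)) N ε)) →
      (∀ (z : Config N (Fin 3) T3) (s : ℝ), 0 ≤ s →
        ∀ {m : ℕ} (r : Fin m → ℝ), (∀ i, 0 ≤ r i ∧ r i ≤ s) →
        ∀ {Q : Set (Fin m → Config N (Fin 3) T3)}, MeasurableSet Q →
        ∀ {H : Config N (Fin 3) T3 × (ℕ → V3) → ℝ≥0∞}, Measurable H →
          ∫⁻ ξs, {ξs : ℕ → V3 |
              (∃ k, ENNReal.ofReal s < lambertInstant (Torus.geometry (Fin 3)) ε ξs z k) ∧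
              (fun i => lambertFlow (Torus.geometry (Fin 3)) ε ξs z (r i)) ∈ Q}.indicator
              (fun ξs => H (lambertFlow (Torus.geometry (Fin 3)) ε ξs z s,
                fun n => ξs (n + lambertCount (Torus.geometry (Fin 3)) ε ξs z s))) ξs
              ∂(lambertNoise (Fin 3)) =
          ∫⁻ ξs, {ξs : ℕ → V3 |
              (∃ k, ENNReal.ofReal s < lambertInstant (Torus.geometry (Fin 3)) ε ξs z k) ∧
              (fun i => lambertFlow (Torus.geometry (Fin 3)) ε ξs z (r i)) ∈ Q}.indicator
              (fun ξs => ∫⁻ ηs, H (lambertFlow (Torus.geometry (Fin 3)) ε ξs z s, ηs)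
                ∂(lambertNoise (Fin 3))) ξs
              ∂(lambertNoise (Fin 3))) →
      (∀ t : ℝ, 0 ≤ t →
        ((liouville (Torus.geometry (Fin 3)) N ε).prod (lambertNoise (Fin 3))).map
            (fun p => lambertFlow (Torus.geometry (Fin 3)) ε p.2 p.1 t) =
          liouville (Torus.geometry (Fin 3)) N ε) ∧
      (∀ᵐ p ∂((liouville (Torus.geometry (Fin 3)) N ε).prod (lambertNoise (Fin 3))),
        ∀ T : ℝ, ∃ k, ENNReal.ofReal T < lambertInstant (Torus.geometry (Fin 3)) ε p.2 p.1 k) := by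
  intro ε hε hε' N hW hM
  haveI := sigmaFinite_volume_config N
  have hD : MeasurableSet (hardSphereDomain G₃ N ε) := measurableSet_hardSphereDomain _ Torus.measurable_geometry_sepVec N ε
  have hshell := fun (V : ℕ) (t : ℝ) (ht : 0 ≤ t) => lambda_shell_bounds hM hW hε hε' (Nat.cast_nonneg V) ht
  -- the energy shells of the domain, indexed by natural speed bounds, exhaust the domain
  set Sh : ℕ → Set (Config N (Fin 3) T3) := fun V =>
    {z | z ∈ hardSphereDomain G₃ N ε ∧ configEnergy z ≤ (V : ℝ) ^ 2 / 2} with hSh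
  have hmono : ∀ {a b : ℕ}, a ≤ b → Sh a ⊆ Sh b := fun {a b} hab z hz =>
    ⟨hz.1, by nlinarith [hz.2, (Nat.cast_le.2 hab : (a : ℝ) ≤ b), (Nat.cast_nonneg a : (0 : ℝ) ≤ a)]⟩
  have hexh : ∀ X : Set (Config N (Fin 3) T3), X ∩ hardSphereDomain G₃ N ε = ⋃ V : ℕ, (Sh V ∩ X) := by
    refine fun X => Set.ext fun z => ?_
    simp only [mem_inter_iff, mem_iUnion, mem_setOf_eq, hSh]
    exact ⟨fun h => (exists_nat_configEnergy_le z).elim fun V hV => ⟨V, ⟨h.2, hV⟩, h.1⟩, fun ⟨V, hV, hX⟩ => ⟨hX, hV.1⟩⟩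
  refine ⟨fun t ht => ?_, ?_⟩
  · have hΛ := measurable_lambertFlow_torus (d := Fin 3) (N := N) hε' t
    ext B hB
    rw [Measure.map_apply hΛ hB, liouville_eq, Measure.restrict_prod_eq_prod_univ,
      Measure.restrict_apply (hΛ hB), Measure.restrict_apply hB]
    have hL : (fun p : Config N (Fin 3) T3 × (ℕ → V3) => lambertFlow G₃ ε p.2 p.1 t) ⁻¹' B ∩
        hardSphereDomain G₃ N ε ×ˢ (univ : Set (ℕ → V3)) =
          ⋃ V : ℕ, (Sh V ×ˢ (univ : Set (ℕ → V3)) ∩ {p | lambertFlow G₃ ε p.2 p.1 t ∈ B}) := by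
      ext p
      have h := Set.ext_iff.1 (hexh ((fun z : Config N (Fin 3) T3 => lambertFlow G₃ ε p.2 z t) ⁻¹' B)) p.1
      simpa only [mem_inter_iff, mem_preimage, mem_prod, mem_univ, and_true, true_and, mem_iUnion, mem_setOf_eq, and_comm] using h
    show (volume.prod γ₃) ((fun p : Config N (Fin 3) T3 × (ℕ → V3) => lambertFlow G₃ ε p.2 p.1 t) ⁻¹' B ∩
        hardSphereDomain G₃ N ε ×ˢ (univ : Set (ℕ → V3))) = volume (B ∩ hardSphereDomain G₃ N ε)
    have hmL : Monotone fun V : ℕ => Sh V ×ˢ (univ : Set (ℕ → V3)) ∩ {p | lambertFlow G₃ ε p.2 p.1 t ∈ B} :=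
      fun a b hab p hp => ⟨⟨hmono hab hp.1.1, hp.1.2⟩, hp.2⟩
    have hmR : Monotone fun V : ℕ => Sh V ∩ B := fun a b hab z hz => ⟨hmono hab hz.1, hz.2⟩
    rw [hL, hexh B, hmL.measure_iUnion, hmR.measure_iUnion]
    exact iSup_congr fun V => measure_shell_inter_preimage_eq hε' (Nat.cast_nonneg V) (hshell V t ht).1 (hshell V t ht).2 hB
  · rw [liouville_eq, Measure.restrict_prod_eq_prod_univ, ae_restrict_iff' (hD.prod MeasurableSet.univ), ae_iff]
    refine measure_mono_null ?_ (measure_iUnion_null fun T : ℕ =>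
      measure_iUnion_null fun V : ℕ => (hshell V T (Nat.cast_nonneg T)).2)
    intro p hp
    rw [mem_setOf_eq, Classical.not_imp, not_forall] at hp
    obtain ⟨hpD, T, hT⟩ := hp
    obtain ⟨n, hn⟩ := exists_nat_ge T
    obtain ⟨V, hV⟩ := exists_nat_configEnergy_le p.1
    refine mem_iUnion.2 ⟨n, mem_iUnion.2 ⟨V, ⟨⟨hpD.1, hV⟩, mem_univ _⟩, Or.inl fun ⟨k, hk⟩ => hT ⟨k, ?_⟩⟩⟩
    exact lt_of_le_of_lt (ENNReal.ofReal_le_ofReal hn) hk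

end Summit.AtomisticToContinuum.HydrodynamicLimit.Theorems.LambertianContactSwapLambertianEulerIterate

end
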